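import Summits.BirchSwinnertonDyer.BirchSwinnertonDyer.Theorems.PrintX8SharpFlatMuDefect
import Literature.NumberTheory.EllipticCurves.SkinnerUrban2014.CharacteristicIdealBaseChangeProofs
import Literature.NumberTheory.EllipticCurves.Kato2004.MainConjectureSkeletonProofs
import Literature.NumberTheory.EllipticCurves.CyclotomicIwasawaMainTheoremIrreducibleProofs
import Literature.NumberTheory.EllipticCurves.KatoRankBoundMultiplicativeProofs
import HarnessLib

/-!
# Crux `SprungLowerDivisibilityAtThree` (item stmt-BirchSwinnertonDyer-19875), line `chromatic-common-zeros`: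
# stub S1 `stub_squeezeToCommonZeros` — the Eisenstein half of Sprung's ♯/♭ main conjecture REDUCES to
# the common-zero locus of the two chromatic `p`-adic `L`-functions (kernel theorem, image-free, rank-free)

Cell `bsd-ssimc` (host) / lead `cruxlead-stmt-BirchSwinnertonDyer-19875`; `--supports` 19875; theorems only;
BSD / K1 / leaf X8 are NOT proved by anything here.

THE LEVER (Sprung 2012 Thm. 7.14 (3) + Prop. 7.19 with Kato 2004 Thm. 12.5/12.6, prime by prime). Both
chromatic Poitou–Tate sequences `0 → 𝐇¹(T) →^{Col^•} Λ → X^• → X₀ → 0` (`• = ♯, ♭`) live on ONE Kato module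
`𝐇¹(T)` with ONE zeta submodule `Z`. At a height-one prime `𝔭` of `Λ = ℤ_p⟦T⟧` AVOIDED by the
Néron-normalised `L`-function `G^∘ = ϖ·L^∘` of SOME colour `∘`, injectivity of `Col^∘` (`L^∘ ≠ 0`) gives
`𝐇¹/Z ↪ Λ/Col^∘(Z)` and `Col^∘(Z)_𝔭 = (G^∘)_𝔭 = Λ_𝔭` (Def. 6.1 read on ideals), so `length_𝔭(𝐇¹/Z) = 0`;
the four-term identity for the colour `•` under study (tree THEOREM
`SharpFlatColemanKatoData.lengthAt_add_eq`: `ℓ_𝔭 X^• + ℓ_𝔭(𝐇¹/Z) = ℓ_𝔭 X₀ + ℓ_𝔭 Λ/(G^•)`) then yields the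
local Eisenstein inequality `ℓ_𝔭 Λ/(G^•) ≤ ℓ_𝔭 X^•` for free. Hence the Eisenstein half
`(ϖ·L^•) ∣ gen(char_Λ X^•)` holds as soon as the local inequality is known at the COMMON zeros of
`(ϖL♯, ϖL♭)` only — globalised over the UFD `Λ` by §1 below (`char X^•` is principal; a principal ideal
is divisible by `G` iff `ord_𝔭 G ≤ ℓ_𝔭` at every height-one `𝔭`).

Contents. §1 generic commutative algebra over a Noetherian UFD (the EISENSTEIN twin of the tree's
`Module.exists_pow_mul_mem_charIdeal_of_lengthAt_le`): `dvd_of_forall_lengthAt_quotient_le`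
(`ℓ_𝔭 R/(G) ≤ ℓ_𝔭 R/(g)` at all height-one `𝔭` ⟹ `G ∣ g`) and
`exists_charIdeal_eq_span_mul_of_lengthAt_quotient_le` (`ℓ_𝔭 R/(G) ≤ ℓ_𝔭 X` at all height-one `𝔭`,
`X` f.g. torsion ⟹ `char X = (G·h)`). §2 the registered stub `stub_squeezeToCommonZeros` of the skeleton
`Cruxes/SprungLowerDivisibilityAtThree/Lines/chromatic_common_zeros.lean` (lead's reshape 2026-08-28: the
joint two-colour Coleman–Kato package enters as BINDERS `I, Cs, Cf, Cs.Z = Cf.Z` — tree vocabulary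
`Sprung2012.SharpFlatColemanKatoData` — instead of the un-typed Prop `JointColemanKatoZeta`, and Thm. 7.14's
output as the binders `[Module.Finite Λ D.X]`, `Module.IsTorsion Λ D.X`; the composition
`lowerDivisibility_of_stubs` supplies them from `stub_heldInputs`). The guard `chromaticL • ≠ 0` is USED
(four-term identity for `•`); no image hypothesis; no `μ`; no rank.

References: [Sprung2012] Def. 6.1 (p. 1495), Thm. 7.14 with (3) (p. 1504), Prop. 7.19 (p. 1505);
[Kato2004Asterisque] Thm. 12.5/12.6 (p. 222), §17.13 (p. 280); [Washington1997] §13.2;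
[SkinnerUrban2014] §3.1.6 (char determines height-one lengths); tree: `PrintX8SharpFlatMuDefect` §1,
`SmallImageSignedMuDefect` §1, `IwasawaAlgebraDivisibilityProofs`, `SkinnerUrban2014/CharacteristicIdealBaseChangeProofs`
(Determines), `Kato2004/MainConjectureSkeletonProofs` (`charIdeal_eq_span_of_lengthAt_eq_quotient`).
-/

set_option linter.dupNamespace false
set_option autoImplicit false

noncomputable section

open scoped Classical NumberField MatrixGroups ModularForm

open NumberField IsDedekindDomain CongruenceSubgroup WeierstrassCurve Field
  Literature.NumberTheory.EllipticCurves Literature.NumberTheory.EllipticCurves.ModularForms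
  Literature.NumberTheory.EllipticCurves.ZpExtension Literature.NumberTheory.EllipticCurves.Sprung2017
  Literature.NumberTheory.EllipticCurves.Sprung2012 Literature.NumberTheory.EllipticCurves.Rank1Residual
  Summit.BirchSwinnertonDyer.BirchSwinnertonDyer.Theorems
  Summit.BirchSwinnertonDyer.BirchSwinnertonDyer.Theorems.SmallImageSignedMuDefect

namespace Summit.BirchSwinnertonDyer.BirchSwinnertonDyer.Theorems.ChromaticCommonZeros

/-! ### §1 Generic: from length inequalities `ℓ_𝔭 R/(G) ≤ ℓ_𝔭(·)` to divisibility by `G` -/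

section Algebra

variable {R : Type*} [CommRing R] [IsDomain R] [IsNoetherianRing R] [UniqueFactorizationMonoid R]

/-- **`ord_𝔭 G ≤ ord_𝔭 g` at every height-one prime ⟹ `G ∣ g`** (Noetherian UFD; `G ≠ 0`): induction on
the prime factorisation of `G` — for a prime factor `a`, `ℓ_{(a)} R/(g) ≥ 1` gives `a ∣ g`
(`Module.pow_dvd_of_le_lengthAt_quotient`), and `ℓ_𝔭 R/(ab) = ℓ_𝔭 R/(a) + ℓ_𝔭 R/(b)` with
`ℓ_𝔭 R/(a) ∈ {0, 1}` cancels. [cite: Washington1997, §13.2] -/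
theorem dvd_of_forall_lengthAt_quotient_le {G : R} (hG : G ≠ 0) (g : R)
    (h : ∀ 𝔭 : PrimeSpectrum R, 𝔭.asIdeal.height = 1 →
      Module.lengthAt R (R ⧸ Ideal.span {G}) 𝔭 ≤ Module.lengthAt R (R ⧸ Ideal.span {g}) 𝔭) :
    G ∣ g := by
  classical
  set s : Multiset R := UniqueFactorizationMonoid.factors G with hs
  have hprime : ∀ π ∈ s, Prime π := fun π hπ => UniqueFactorizationMonoid.prime_of_factor π hπ
  have hassoc : Associated s.prod G := UniqueFactorizationMonoid.factors_prod hG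
  rw [← hassoc.dvd_iff_dvd_left]
  have h' : ∀ 𝔭 : PrimeSpectrum R, 𝔭.asIdeal.height = 1 →
      Module.lengthAt R (R ⧸ Ideal.span {s.prod}) 𝔭 ≤ Module.lengthAt R (R ⧸ Ideal.span {g}) 𝔭 := by
    intro 𝔭 h𝔭
    have hspan : Ideal.span {s.prod} = Ideal.span {G} :=
      Ideal.span_singleton_eq_span_singleton.mpr hassoc
    rw [Module.lengthAt_eq_of_linearEquiv (Submodule.quotEquivOfEq _ _ hspan) 𝔭]
    exact h 𝔭 h𝔭
  clear_value s
  clear h hassoc hs hG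
  induction s using Multiset.induction_on generalizing g with
  | empty => rw [Multiset.prod_zero]; exact one_dvd g
  | cons a s ih =>
    have ha : Prime a := hprime a (Multiset.mem_cons_self a s)
    have hs' : ∀ π ∈ s, Prime π := fun π hπ => hprime π (Multiset.mem_cons_of_mem hπ)
    by_cases hg : g = 0
    · rw [hg]; exact dvd_zero _
    -- the height-one prime `(a)`
    haveI : (Ideal.span {a}).IsPrime := (Ideal.span_singleton_prime ha.ne_zero).mpr ha
    let 𝔮 : PrimeSpectrum R := ⟨Ideal.span {a}, inferInstance⟩
    have h𝔮 : 𝔮.asIdeal.height = 1 := Module.height_span_singleton_eq_one_of_prime ha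
    -- `a ∣ g`
    have hag : a ∣ g := by
      have h1 := h' 𝔮 h𝔮
      rw [Multiset.prod_cons, Module.lengthAt_quotient_span_singleton_mul _ ha.ne_zero,
        Module.lengthAt_quotient_span_singleton ha 𝔮 h𝔮, if_pos (Ideal.mem_span_singleton_self a)] at h1
      have h2 : ((1 : ℕ) : ℕ∞) ≤ Module.lengthAt R (R ⧸ Ideal.span {g}) 𝔮 :=
        le_trans (by exact_mod_cast le_rfl) (le_trans le_self_add h1)
      simpa using Module.pow_dvd_of_le_lengthAt_quotient ha hg 𝔮 rfl h2
    obtain ⟨g', rfl⟩ := hag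
    rw [Multiset.prod_cons]
    refine mul_dvd_mul_left a (ih g' hs' ?_)
    intro 𝔭 h𝔭
    have h1 := h' 𝔭 h𝔭
    rw [Multiset.prod_cons, Module.lengthAt_quotient_span_singleton_mul _ ha.ne_zero,
      Module.lengthAt_quotient_span_singleton_mul _ ha.ne_zero] at h1
    have hfin : Module.lengthAt R (R ⧸ Ideal.span {a}) 𝔭 ≠ ⊤ := by
      rw [Module.lengthAt_quotient_span_singleton ha 𝔭 h𝔭]
      split_ifs <;> simp
    exact (ENat.add_le_add_iff_left hfin).mp h1

/-- **The Eisenstein bridge: `ℓ_𝔭 R/(G) ≤ ℓ_𝔭 X` at every height-one prime ⟹ `char X = (G·h)`** for a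
finitely generated torsion module `X` over a Noetherian UFD and `G ≠ 0` (twin of the tree's Kato-side
`Module.exists_pow_mul_mem_charIdeal_of_lengthAt_le`): `char X = (gen)` is principal
(`SkinnerUrban2014.exists_charIdeal_eq_span_prod`), `gen ≠ 0` (`Module.charIdeal_ne_bot`), the height-one
lengths of `X` are those of `R/(gen)` (`SkinnerUrban2014.lengthAt_eq_of_charIdeal_eq` with
`Module.charIdeal_eq_span_of_lengthAt_eq_quotient`), and `dvd_of_forall_lengthAt_quotient_le` concludes.
[cite: Washington1997, §13.2] [cite: SkinnerUrban2014, §3.1.6 (p. 20)] -/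
theorem exists_charIdeal_eq_span_mul_of_lengthAt_quotient_le {X : Type*} [AddCommGroup X] [Module R X]
    [Module.Finite R X] (hX : Module.IsTorsion R X) {G : R} (hG : G ≠ 0)
    (h : ∀ 𝔭 : PrimeSpectrum R, 𝔭.asIdeal.height = 1 →
      Module.lengthAt R (R ⧸ Ideal.span {G}) 𝔭 ≤ Module.lengthAt R X 𝔭) :
    ∃ gen h : R, Module.charIdeal R X = Ideal.span {gen} ∧ gen = G * h := by
  classical
  obtain ⟨t, π, -, -, -, hchar⟩ := SkinnerUrban2014.exists_charIdeal_eq_span_prod hX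
  set gen : R := ∏ 𝔭 ∈ t, π 𝔭 ^ (Module.lengthAt R X 𝔭).toNat with hgendef
  have hgen : gen ≠ 0 := by
    intro h0
    apply Module.charIdeal_ne_bot R X
    rw [hchar, h0, Ideal.span_singleton_eq_bot]
  have hQt : Module.IsTorsion R (R ⧸ Ideal.span {gen}) := by
    intro q
    refine ⟨⟨gen, mem_nonZeroDivisors_of_ne_zero hgen⟩, ?_⟩
    have hTB : Module.IsTorsionBy R (R ⧸ Ideal.span {gen}) gen :=
      (Module.isTorsionBy_quotient_iff _ _).mpr fun x =>
        Ideal.mul_mem_right x _ (Ideal.mem_span_singleton_self gen)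
    exact @hTB q
  have hchar' : Module.charIdeal R X = Module.charIdeal R (R ⧸ Ideal.span {gen}) := by
    rw [hchar, Module.charIdeal_eq_span_of_lengthAt_eq_quotient hgen (fun _ _ => rfl)]
  have hlen : ∀ 𝔭 : PrimeSpectrum R, 𝔭.asIdeal.height = 1 →
      Module.lengthAt R X 𝔭 = Module.lengthAt R (R ⧸ Ideal.span {gen}) 𝔭 := fun 𝔭 h𝔭 =>
    SkinnerUrban2014.lengthAt_eq_of_charIdeal_eq hX hQt hchar' 𝔭 h𝔭
  obtain ⟨h', hh⟩ := dvd_of_forall_lengthAt_quotient_le hG gen fun 𝔭 h𝔭 =>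
    (hlen 𝔭 h𝔭) ▸ h 𝔭 h𝔭
  exact ⟨gen, h', hchar, hh⟩

end Algebra

/-! ### §2 The registered stub S1 of line `chromatic-common-zeros` -/

/-- **Stub S1 `stub_squeezeToCommonZeros` (line `chromatic-common-zeros`, crux
`SprungLowerDivisibilityAtThree`, item stmt-BirchSwinnertonDyer-19875) — REDUCTION TO THE COMMON-ZERO
LOCUS.** In the binder telescope of `Theorems.SprungSharpFlatLowerDivisibility W p •` on class X8
(cyclotomic `(κ, γ)`, place `v ∣ p`, lift `g`, Honda system `(cneg, c)`, newform `f`, period ratio `ϖ`,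
Sprung pair `(L♯, L♭)` with `L^• ≠ 0`), for a dual datum `D` of `Sel^•(E/ℚ_∞)` that is finitely
generated `Λ`-torsion (Thm. 7.14), a Néron-normalised `G` (`ι G = C(ϖ)·ι L^•`), and the JOINT ♯/♭
Coleman–Kato packages `Cs`, `Cf` on one pinned `I = 𝐇¹_Γ(T_pW)` with the SAME zeta submodule
(`Cs.Z = Cf.Z`): IF the local Eisenstein inequality `ℓ_𝔭 Λ/(G) ≤ ℓ_𝔭 D.X` holds at every height-one
prime `𝔭` containing the normalised `L`-function of EVERY colour (the common zeros), THEN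
`char_Λ D.X = (gen)` with `ι gen = C(ϖ)·ι(L^•·h)` — the conclusion of K1 for this datum. Proof: at a
non-common `𝔭` some colour `∘` has `G^∘ ∉ 𝔭` (so `L^∘ ≠ 0`); if `∘ = •` the left side vanishes;
otherwise `Col^∘` is injective, `𝐇¹/Z ↪ Λ/Col^∘(Z)` (`lengthAt_quotient_map_eq_add`) and `Col^∘(Z) ⊄ 𝔭`
(`image_zeta_localized`: `s·G^∘ ∈ Col^∘(Z)`, `s, G^∘ ∉ 𝔭`), so `ℓ_𝔭(𝐇¹/Z) = 0` and the four-term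
identity for `•` (`SharpFlatColemanKatoData.lengthAt_add_eq`, guard `L^• ≠ 0` used) gives the
inequality; globalise by `exists_charIdeal_eq_span_mul_of_lengthAt_quotient_le` (`G ≠ 0` as `ϖ ≠ 0`,
`L^• ≠ 0`). Image-free, rank-free, `μ`-free. [cite: Sprung2012, Def. 6.1 (p. 1495), Thm. 7.14 (3) (p. 1504), Prop. 7.19 (p. 1505)]
[cite: Kato2004Asterisque, Thm. 12.5 and Thm. 12.6 (p. 222), §17.13 (p. 280)] [cite: Washington1997, §13.2] -/
theorem stub_squeezeToCommonZeros :
    ∀ (W : WeierstrassCurve ℚ) [W.IsElliptic] [W.IsGloballyMinimal] (p : ℕ) [Fact p.Prime]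
      [ContinuousSMul ℤ_[p] (W.tateModule p)] [Module.Free ℤ_[p] (W.tateModule p)]
      [Module.Finite ℤ_[p] (W.tateModule p)],
      ClassX8 W p → ∀ (col : Chroma) (κ : ZpExtension ℚ p) (γ : Field.absoluteGaloisGroup ℚ),
      κ.IsCyclotomic → κ.IsTopGenerator γ → IsCyclotomicVariable p γ →
    ∀ (v : HeightOneSpectrum (𝓞 ℚ)), (p : 𝓞 ℚ) ∈ v.asIdeal →
    ∀ (g : Field.absoluteGaloisGroup (v.adicCompletion ℚ)),
      κ.IsTopGenerator (resGalOfEmb (closureEmb (K := ℚ) (v.adicCompletion ℚ)) g) →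
    ∀ (cneg : localPoints W (v.adicCompletion ℚ)) (c : ℕ → localPoints W (v.adicCompletion ℚ)),
      IsHondaSystem κ (closureEmb (K := ℚ) (v.adicCompletion ℚ)) W (W.frobeniusTrace p) g cneg c →
    ∀ (N : ℕ) (_ : NeZero N) (f : CuspForm (Gamma0 N) 2) (ϖ : ℚ) (Lsharp Lflat : IwasawaAlgebra p),
      IsNewformOf W f → (ϖ : ℝ) * W.realPeriodRat = plusPeriod f →
      IsSprungPair f p (W.frobeniusTrace p) Lsharp Lflat → chromaticL col Lsharp Lflat ≠ 0 →
    ∀ (D : SharpFlatSelmerDualData W κ γ (closureEmb (K := ℚ) (v.adicCompletion ℚ))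
        (W.frobeniusTrace p) g c col) [Module.Finite (IwasawaAlgebra p) D.X],
      Module.IsTorsion (IwasawaAlgebra p) D.X →
    ∀ (G : IwasawaAlgebra p),
      iwasawaToPowerSeries p G =
        PowerSeries.C (ϖ : ℚ_[p]) * iwasawaToPowerSeries p (chromaticL col Lsharp Lflat) →
    ∀ (I : Kato2004.IwasawaH1Data W p κ γ)
      (Cs : SharpFlatColemanKatoData W p f ϖ κ γ (closureEmb (K := ℚ) (v.adicCompletion ℚ))
        (W.frobeniusTrace p) g c Chroma.sharp I)
      (Cf : SharpFlatColemanKatoData W p f ϖ κ γ (closureEmb (K := ℚ) (v.adicCompletion ℚ))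
        (W.frobeniusTrace p) g c Chroma.flat I),
      Cs.Z = Cf.Z →
      (∀ 𝔭 : PrimeSpectrum (IwasawaAlgebra p), 𝔭.asIdeal.height = 1 →
        (∀ (col' : Chroma) (G' : IwasawaAlgebra p),
          iwasawaToPowerSeries p G' =
            PowerSeries.C (ϖ : ℚ_[p]) * iwasawaToPowerSeries p (chromaticL col' Lsharp Lflat) →
          G' ∈ 𝔭.asIdeal) →
        Module.lengthAt (IwasawaAlgebra p) (IwasawaAlgebra p ⧸ Ideal.span {G}) 𝔭 ≤
          Module.lengthAt (IwasawaAlgebra p) D.X 𝔭) →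
      ∃ gen h : IwasawaAlgebra p, D.charIdeal = Ideal.span {gen} ∧
        iwasawaToPowerSeries p gen =
          PowerSeries.C (ϖ : ℚ_[p]) * iwasawaToPowerSeries p (chromaticL col Lsharp Lflat * h) := by
  intro W _ _ p _ _ _ _ hX col κ γ _hκ hγ _hcv v _hv g _hg cneg c _hH N _hN f ϖ Lsharp Lflat hf hϖ hSP
    hcol D _ hXt G hG I Cs Cf hZ hcommon
  classical
  obtain ⟨hp3, ⟨hgood, hap⟩, -⟩ := hX
  subst hp3
  have hirr : W.HasIrreducibleModPGaloisRep 3 :=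
    hasIrreducibleModPGaloisRep_of_dvd_frobeniusTrace W 3 (by decide)
      (W.not_dvd_minimalDiscriminantInt_of_hasGoodReductionAtPrime' 3 hgood) hap
  -- `ϖ ≠ 0` (`Ω⁺_f > 0`), hence `G ≠ 0`
  have hϖ0 : ϖ ≠ 0 := hf.periodRatio_ne_zero hϖ
  have hG0 : G ≠ 0 := by
    intro h0
    rw [h0, map_zero, eq_comm, mul_eq_zero] at hG
    rcases hG with hC | hL
    · have h1 : ((ϖ : ℚ) : ℚ_[3]) = 0 := by simpa using congrArg PowerSeries.constantCoeff hC
      exact hϖ0 (by exact_mod_cast h1)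
    · exact hcol (iwasawaToPowerSeries_injective 3 (by rw [hL, map_zero]))
  -- the local Eisenstein inequality at EVERY height-one prime
  have hloc : ∀ 𝔭 : PrimeSpectrum (IwasawaAlgebra 3), 𝔭.asIdeal.height = 1 →
      Module.lengthAt (IwasawaAlgebra 3) (IwasawaAlgebra 3 ⧸ Ideal.span {G}) 𝔭 ≤
        Module.lengthAt (IwasawaAlgebra 3) D.X 𝔭 := by
    intro 𝔭 h𝔭
    by_cases hc : ∀ (col' : Chroma) (G' : IwasawaAlgebra 3),
        iwasawaToPowerSeries 3 G' =
          PowerSeries.C (ϖ : ℚ_[3]) * iwasawaToPowerSeries 3 (chromaticL col' Lsharp Lflat) →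
        G' ∈ 𝔭.asIdeal
    · exact hcommon 𝔭 h𝔭 hc
    push Not at hc
    obtain ⟨col', G', hG', hG'𝔭⟩ := hc
    by_cases hcc : col' = col
    · -- same colour: `G' = G ∉ 𝔭`, the left side vanishes
      subst hcc
      have hGG : G' = G := iwasawaToPowerSeries_injective 3 (by rw [hG', hG])
      rw [Module.lengthAt_quotient_eq_zero_of_not_le
        (by rwa [Ideal.span_singleton_le_iff_mem, ← hGG])]
      exact bot_le
    · -- the OTHER colour `∘ = col'` avoids `𝔭`: squeeze through the shared zeta line
      have hcol' : chromaticL col' Lsharp Lflat ≠ 0 := by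
        intro h0
        apply hG'𝔭
        have : G' = 0 :=
          iwasawaToPowerSeries_injective 3 (by rw [hG', h0, map_zero, mul_zero])
        rw [this]
        exact 𝔭.asIdeal.zero_mem
      obtain ⟨C, C', hZZ⟩ : ∃ (C : SharpFlatColemanKatoData W 3 f ϖ κ γ
            (closureEmb (K := ℚ) (v.adicCompletion ℚ)) (W.frobeniusTrace 3) g c col I)
          (C' : SharpFlatColemanKatoData W 3 f ϖ κ γ
            (closureEmb (K := ℚ) (v.adicCompletion ℚ)) (W.frobeniusTrace 3) g c col' I),
          C.Z = C'.Z := by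
        cases col <;> cases col'
        · exact absurd rfl hcc
        · exact ⟨Cs, Cf, hZ⟩
        · exact ⟨Cf, Cs, hZ.symm⟩
        · exact absurd rfl hcc
      obtain ⟨Y⟩ := W.nonempty_fineSelmerDualData κ hγ
      have h4 := C.lengthAt_add_eq W 3 hirr hSP hcol hG D Y 𝔭 h𝔭
      obtain ⟨s, hs, hsG', -⟩ := C'.image_zeta_localized hirr Lsharp Lflat G' hSP hG' 𝔭 h𝔭
      have hnot : ¬ Submodule.map C'.colMap C'.Z ≤ 𝔭.asIdeal := fun hle =>
        (𝔭.isPrime.mem_or_mem (hle hsG')).elim hs hG'𝔭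
      have hHZ : Module.lengthAt (IwasawaAlgebra 3) (I.H ⧸ C.Z) 𝔭 = 0 := by
        have hsum := lengthAt_quotient_map_eq_add C'.colMap
          (C'.colMap_injective Lsharp Lflat hSP hcol') C'.Z 𝔭
        rw [Module.lengthAt_quotient_eq_zero_of_not_le hnot] at hsum
        rw [hZZ]
        exact nonpos_iff_eq_zero.mp (le_self_add.trans (le_of_eq hsum.symm))
      rw [hHZ, add_zero] at h4
      rw [h4]
      exact le_add_self
  -- globalise over the UFD `Λ = ℤ₃⟦T⟧`
  obtain ⟨gen, h, hgen, hh⟩ := exists_charIdeal_eq_span_mul_of_lengthAt_quotient_le hXt hG0 hloc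
  refine ⟨gen, h, hgen, ?_⟩
  rw [hh, map_mul, hG, map_mul, mul_assoc]

end Summit.BirchSwinnertonDyer.BirchSwinnertonDyer.Theorems.ChromaticCommonZeros

end
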